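/-
Copyright (c) 2026 the pub-hodgecm-mathlib formalisation cell (harness21).  Prover seat hodgecm-mathlib-K2Liu-p09 (g5): Track B «K2-LIT»,
hLiu418 = stmt-HodgeConjecture-24832; LEAD F0P6-plan RULINGS M-156m∕M-156o «A7 = GK COCYCLE ROAD», file B4c-3 (algebra for B4-concrete).
-/
import Summits.HodgeConjecture.HodgeConjecture.Theorems.K2LiuDoubledUTwoTwoRankOneRelationsLevi   -- ★ B4c-2 (+ ★ B1a-1∕2∕3 letters)
import HarnessLib

/-!
# Crux `HLiu418`, road `K2_Liu`, organ A7-reg (GK cocycle road), file B4c-3: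
# THE STEP RELATIONS `w_α u_α(y) · n = n′(y) · w_α u_α(y + c)` AND `w_α u_α(y) · t = t′ · w_α u_α(c y)` OF `U(J₄)`

Cell `hodgecm-mathlib`, crux item hLiu418 = `stmt-HodgeConjecture-24832`; squad K2 ∕ K2Liu; prover K2Liu-p09 (g5).
THEOREMS ONLY (no `def`, no instance, no notation, no named-fact hypothesis, no `sorry`); lane `--supports stmt-HodgeConjecture-24832`
(count-neutral helper).  Pure algebra over a commutative ring `R` with an involution `σ`, on K2Liu-p03 (g6)'s ★ letters (RULING M-156o (c)).

These are the word identities behind the EQUIVARIANCE clauses ★ `K2LiuRankOneOperators.integral_mul_torus ∕ integral_mul_unipotent` for the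
`α₂`-steps `𝒜 = A_{2e₂}` of the cocycle `M = A₂ A₁ A₂` (the operator `g ↦ ∫_y f(w₂ u_{2e₂}(y) g) dy`): moving an element of the Borel
`B = T · N_B`, `N_B = N_Δ ⋊ U_{e₁−e₂}`, from the right of `w₂ u_{2e₂}(y)` to the left produces ONLY letters on which a Siegel section's
character is trivial (unipotent letters of `P_Δ`) or a torus letter, and translates ∕ rescales the root variable `y`:
* §1 `weylTwo_mul_uPlus` (`w₂ u₊(z) = u₋(z) w₂`) and the three unipotent clauses
  **`weylTwo_uLongTwo_mul_uMinus`**: `w₂u(y)·u₋(r) = u₊(r)·u_{2e₁}(rσ(r)y)·u₋(−ry) · w₂u(y)` (the prefix depends on `y` but is unipotent in `P_Δ`),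
  `weylTwo_uLongTwo_mul_uPlus`: `w₂u(y)·u₊(b) = u₋(b)·w₂u(y)`, `weylTwo_uLongTwo_mul_uLongOne`: `w₂u(y)·u_{2e₁}(c) = u_{2e₁}(c)·w₂u(y)`
  (the fourth, `w₂u(y)·u(b) = w₂u(y+b)`, is ★ B4c-1 `weylTwo_mul_uLongTwo_mul_uLongTwo`);
* §2 the torus clause **`weylTwo_uLongTwo_mul_torusElt`**: `w₂u(y)·t(a,b) = t(a, σ(b)⁻¹) · w₂u((bσb)⁻¹ y)`;
* §3 for the `α₁`-steps (partial Weyl letters `P_ε = m(εW + (1−ε)1)` of ★ B4c-2): **`leviElt_partialWeyl_mul_torusElt`**: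
  `P_ε · t(a,b) = t(a′,b′) · P_ε` with `a′ = (1−ε)a + εb`, `b′ = (1−ε)b + εa` (the coordinates are swapped on the `ε`-component only).
HONEST LABEL.  `HC_CM` is proved only modulo the 7 printed citations (2 remaining named inputs: hLiu418 = `stmt-HodgeConjecture-24832`,
h413 = `stmt-HodgeConjecture-24833`) until rung 0 closes.

## References
* [Casselman1980] W. Casselman, *The unramified principal series of p-adic groups I*, Compositio Math. 40 (1980), §3 (`N = U_α N^α`, the rank-one
  operator is a `B`-morphism `Ind(λ) → Ind(s_α λ)`).
* [HarrisKudlaSweet1996] M. Harris, S. Kudla, W. J. Sweet, J. AMS 9 (1996), §1 (1.11)–(1.12) (Siegel parabolic, Levi action on `N_Δ`).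
* [Rogawski1990] J. Rogawski (1990), §1.9 (root subgroups and commutators in quasi-split unitary groups).
-/

set_option autoImplicit false
set_option linter.dupNamespace false -- the mandated namespace repeats `HodgeConjecture.HodgeConjecture`

noncomputable section

open Matrix
open Literature.NumberTheory.Automorphic
open Summit.HodgeConjecture.HodgeConjecture.Cruxes.HLiu418.K2LiuDoubledUTwoTwoBorelFrame
open Summit.HodgeConjecture.HodgeConjecture.Cruxes.HLiu418.K2LiuDoubledUTwoTwoWeylCocycle
open Summit.HodgeConjecture.HodgeConjecture.Cruxes.HLiu418.K2LiuDoubledUTwoTwoLevi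
open Summit.HodgeConjecture.HodgeConjecture.Cruxes.HLiu418.K2LiuDoubledUTwoTwoRankOneRelationsLevi

namespace Summit.HodgeConjecture.HodgeConjecture.Cruxes.HLiu418.K2LiuDoubledUTwoTwoStepRelations

variable {R : Type*} [CommRing R] {σ : R →+* R}

/-! ## §1 The unipotent clauses of the `α₂`-step -/

/-- `w₂ u_{e₁+e₂}(z) = u_{e₁−e₂}(z) w₂` (conjugate of ★ `weylTwo_mul_uMinus` by `w₂`, `w₂² = 1`). [cite: Casselman1980, §3] -/
theorem weylTwo_mul_uPlus (hσ : ∀ x, σ (σ x) = x) (z : R) :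
    weylTwo R σ * uPlus R σ hσ z = uMinus R σ hσ z * weylTwo R σ := by
  apply ext_of_coe
  rw [Subgroup.coe_mul, Units.val_mul, Subgroup.coe_mul, Units.val_mul, coe_weylTwo, coe_uPlus, coe_uMinus]
  ext i j
  fin_cases i <;> fin_cases j <;> simp [weylTwoM, uPlusM, uMinusM, Matrix.mul_apply, Fin.sum_univ_four]

/-- `u_{2e₂}(y) · u_{e₁−e₂}(r) = u_{e₁−e₂}(r) · u_{2e₁}(rσ(r)y) · u_{e₁+e₂}(−ry) · u_{2e₂}(y)` (★ `uMinus_mul_uLongTwo` at `−r`, read backwards).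
[cite: HarrisKudlaSweet1996, §1 (1.11)] [cite: Rogawski1990, §1.9] -/
theorem uLongTwo_mul_uMinus (hσ : ∀ x, σ (σ x) = x) (y r : R) (hy : σ y = -y) :
    uLongTwo R σ y hy * uMinus R σ hσ r =
      uMinus R σ hσ r * uLongOne R σ (r * σ r * y) (by rw [map_mul, map_mul, hσ, hy, mul_neg, mul_comm (σ r)]) *
        uPlus R σ hσ (-(r * y)) * uLongTwo R σ y hy := by
  -- `u₋(−r) u(y) = n(y, −ry, rσ(r)y) u₋(−r)` and `n = u_{2e₁} u₊ u`
  have h := uMinus_mul_uLongTwo R σ hσ (-r) y hy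
  have hn : nSiegel R σ hσ y (-r * y) (-r * σ (-r) * y) hy
      (by rw [map_mul, map_mul, hσ, hy, mul_neg, mul_comm (σ (-r))]) =
      uLongOne R σ (r * σ r * y) (by rw [map_mul, map_mul, hσ, hy, mul_neg, mul_comm (σ r)]) * uPlus R σ hσ (-(r * y)) * uLongTwo R σ y hy := by
    rw [uLongOne_mul_uPlus_mul_uLongTwo]
    congr 1 <;> simp [map_neg, neg_mul, mul_neg, neg_neg]
  -- multiply `h` on the left by `u₋(r)`: `u₋(r) u₋(−r) = 1`
  have h2 : uLongTwo R σ y hy * uMinus R σ hσ r = uMinus R σ hσ r * (uMinus R σ hσ (-r) * uLongTwo R σ y hy) * uMinus R σ hσ r := by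
    rw [← mul_assoc, uMinus_mul, add_neg_cancel, uMinus_zero, one_mul]
  rw [h2, h, hn]
  simp only [mul_assoc]
  rw [uMinus_mul, neg_add_cancel, uMinus_zero, mul_one]

/-- **THE `U_{e₁−e₂}`-CLAUSE**: `w₂ u_{2e₂}(y) · u_{e₁−e₂}(r) = (u_{e₁+e₂}(r) · u_{2e₁}(rσ(r)y) · u_{e₁−e₂}(−ry)) · w₂ u_{2e₂}(y)` — the prefix is a product
of UNIPOTENT letters of `P_Δ` (so a Siegel section does not see it), the root variable `y` is unchanged. [cite: Casselman1980, §3] [cite: HarrisKudlaSweet1996, §1 (1.11)] -/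
theorem weylTwo_uLongTwo_mul_uMinus (hσ : ∀ x, σ (σ x) = x) (y r : R) (hy : σ y = -y) :
    weylTwo R σ * uLongTwo R σ y hy * uMinus R σ hσ r =
      (uPlus R σ hσ r * uLongOne R σ (r * σ r * y) (by rw [map_mul, map_mul, hσ, hy, mul_neg, mul_comm (σ r)]) *
        uMinus R σ hσ (-(r * y))) * (weylTwo R σ * uLongTwo R σ y hy) := by
  rw [mul_assoc (weylTwo R σ), uLongTwo_mul_uMinus hσ y r hy]
  -- move `w₂` through: `w₂ u₋ = u₊ w₂`, `w₂ u_{2e₁} = u_{2e₁} w₂`, `w₂ u₊ = u₋ w₂`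
  simp only [← mul_assoc]
  rw [weylTwo_mul_uMinus, mul_assoc (uPlus R σ hσ r), weylTwo_mul_uLongOne, ← mul_assoc,
    mul_assoc (uPlus R σ hσ r * uLongOne R σ _ _), weylTwo_mul_uPlus hσ, ← mul_assoc]

/-- **the `U_{e₁+e₂}`-clause**: `w₂ u_{2e₂}(y) · u_{e₁+e₂}(b) = u_{e₁−e₂}(b) · w₂ u_{2e₂}(y)`. [cite: Casselman1980, §3] -/
theorem weylTwo_uLongTwo_mul_uPlus (hσ : ∀ x, σ (σ x) = x) (y b : R) (hy : σ y = -y) :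
    weylTwo R σ * uLongTwo R σ y hy * uPlus R σ hσ b = uMinus R σ hσ b * (weylTwo R σ * uLongTwo R σ y hy) := by
  have hcomm : uLongTwo R σ y hy * uPlus R σ hσ b = uPlus R σ hσ b * uLongTwo R σ y hy := by
    apply ext_of_coe
    rw [Subgroup.coe_mul, Units.val_mul, Subgroup.coe_mul, Units.val_mul, coe_uLongTwo, coe_uPlus]
    ext i j
    fin_cases i <;> fin_cases j <;> simp [uLongTwoM, uPlusM, Matrix.mul_apply, Fin.sum_univ_four]
  rw [mul_assoc, hcomm, ← mul_assoc, weylTwo_mul_uPlus hσ, mul_assoc]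

/-- **the `U_{2e₁}`-clause**: `w₂ u_{2e₂}(y) · u_{2e₁}(c) = u_{2e₁}(c) · w₂ u_{2e₂}(y)`. [cite: Casselman1980, §3] -/
theorem weylTwo_uLongTwo_mul_uLongOne (y c : R) (hy : σ y = -y) (hc : σ c = -c) :
    weylTwo R σ * uLongTwo R σ y hy * uLongOne R σ c hc = uLongOne R σ c hc * (weylTwo R σ * uLongTwo R σ y hy) := by
  have hcomm : uLongTwo R σ y hy * uLongOne R σ c hc = uLongOne R σ c hc * uLongTwo R σ y hy := by
    apply ext_of_coe
    rw [Subgroup.coe_mul, Units.val_mul, Subgroup.coe_mul, Units.val_mul, coe_uLongTwo, coe_uLongOne]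
    ext i j
    fin_cases i <;> fin_cases j <;> simp [uLongTwoM, uLongOneM, Matrix.mul_apply, Fin.sum_univ_four]
  rw [mul_assoc, hcomm, ← mul_assoc, weylTwo_mul_uLongOne, mul_assoc]

/-! ## §2 The torus clause of the `α₂`-step -/

/-- `σ`-invariance of `b σ(b)` and skewness of `(b σ b)⁻¹ y`. [cite: Rogawski1990, §1.9] -/
theorem skew_norm_inv_mul (hσ : ∀ x, σ (σ x) = x) (b : Rˣ) {y : R} (hy : σ y = -y) :
    σ ((((b * Units.map (σ : R →* R) b)⁻¹ : Rˣ) : R) * y) = -((((b * Units.map (σ : R →* R) b)⁻¹ : Rˣ) : R) * y) := by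
  have hN : σ (((b * Units.map (σ : R →* R) b : Rˣ) : R)) = ((b * Units.map (σ : R →* R) b : Rˣ) : R) := by
    rw [Units.val_mul, Units.coe_map, MonoidHom.coe_coe, map_mul, hσ, mul_comm]
  have hNi : σ ((((b * Units.map (σ : R →* R) b)⁻¹ : Rˣ) : R)) = (((b * Units.map (σ : R →* R) b)⁻¹ : Rˣ) : R) := by
    refine Units.eq_inv_of_mul_eq_one_left ?_
    conv_lhs => rw [← hN]
    rw [← map_mul]
    first | rw [Units.inv_mul, map_one] | rw [Units.mul_inv, map_one]
  rw [map_mul, hNi, hy, mul_neg]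

/-- **THE TORUS CLAUSE**: `w₂ u_{2e₂}(y) · t(a,b) = t(a, σ(b)⁻¹) · w₂ u_{2e₂}((bσb)⁻¹ y)` — the root variable is rescaled by `α₂(t)⁻¹ = (bσ(b))⁻¹`
(a `σ`-INVARIANT unit: an element of `F_v` at a place) and the torus letter is conjugated by `w₂`. [cite: Casselman1980, §3] [cite: Rogawski1990, §1.9] -/
theorem weylTwo_uLongTwo_mul_torusElt (hσ : ∀ x, σ (σ x) = x) (y : R) (hy : σ y = -y) (a b : Rˣ) :
    weylTwo R σ * uLongTwo R σ y hy * torusElt R σ hσ a b =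
      torusElt R σ hσ a (Units.map (σ : R →* R) b⁻¹) *
        (weylTwo R σ * uLongTwo R σ ((((b * Units.map (σ : R →* R) b)⁻¹ : Rˣ) : R) * y) (skew_norm_inv_mul hσ b hy)) := by
  -- `u(y) t = t u((bσb)⁻¹ y)` from ★ `torusElt_mul_uLongTwo` at `x = (bσb)⁻¹ y`
  have h1 := torusElt_mul_uLongTwo R σ hσ a b ((((b * Units.map (σ : R →* R) b)⁻¹ : Rˣ) : R) * y) (skew_norm_inv_mul hσ b hy)
  have hval : (b : R) * σ (b : R) * ((((b * Units.map (σ : R →* R) b)⁻¹ : Rˣ) : R) * y) = y := by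
    rw [← mul_assoc, show (b : R) * σ (b : R) = ((b * Units.map (σ : R →* R) b : Rˣ) : R) by rfl, Units.mul_inv, one_mul]
  have h2 : uLongTwo R σ y hy * torusElt R σ hσ a b =
      torusElt R σ hσ a b * uLongTwo R σ ((((b * Units.map (σ : R →* R) b)⁻¹ : Rˣ) : R) * y) (skew_norm_inv_mul hσ b hy) := by
    rw [h1]
    congr 2
    exact hval.symm
  rw [mul_assoc, h2, ← mul_assoc, weylTwo_mul_torusElt, mul_assoc]

/-! ## §3 The partial Weyl letter past the torus (the `α₁`-steps) -/

/-- **`P_ε · t(a,b) = t(a′,b′) · P_ε`** with `a′ = (1−ε)a + εb`, `b′ = (1−ε)b + εa` (swap on the `ε`-component; `ε² = ε`).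
[cite: Casselman1980, §3] [cite: HarrisKudlaSweet1996, §1 (1.11)] -/
theorem leviElt_partialWeyl_mul_torusElt (hσ : ∀ x, σ (σ x) = x) {ε : R} (hε : ε * ε = ε)
    (A : GL (Fin 2) R) (hA : (A : Matrix (Fin 2) (Fin 2) R) = !![1 - ε, ε; ε, 1 - ε]) (a b a' b' : Rˣ)
    (ha' : (a' : R) = (1 - ε) * a + ε * b) (hb' : (b' : R) = (1 - ε) * b + ε * a) :
    leviElt R σ hσ A * torusElt R σ hσ a b = torusElt R σ hσ a' b' * leviElt R σ hσ A := by
  let D : GL (Fin 2) R := ⟨!![(a : R), 0; 0, (b : R)], !![((a⁻¹ : Rˣ) : R), 0; 0, ((b⁻¹ : Rˣ) : R)],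
    by ext i j; fin_cases i <;> fin_cases j <;> simp [Matrix.mul_apply, Fin.sum_univ_two, Units.mul_inv],
    by ext i j; fin_cases i <;> fin_cases j <;> simp [Matrix.mul_apply, Fin.sum_univ_two, Units.inv_mul]⟩
  let D' : GL (Fin 2) R := ⟨!![(a' : R), 0; 0, (b' : R)], !![((a'⁻¹ : Rˣ) : R), 0; 0, ((b'⁻¹ : Rˣ) : R)],
    by ext i j; fin_cases i <;> fin_cases j <;> simp [Matrix.mul_apply, Fin.sum_univ_two, Units.mul_inv],
    by ext i j; fin_cases i <;> fin_cases j <;> simp [Matrix.mul_apply, Fin.sum_univ_two, Units.inv_mul]⟩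
  have hGL : A * D = D' * A := by
    refine Units.ext ?_
    simp only [Units.val_mul]
    rw [hA]
    ext i j
    fin_cases i <;> fin_cases j <;> simp [D, D', Matrix.mul_apply, Fin.sum_univ_two, ha', hb'] <;>
      first | (linear_combination (0 : R) * hε) | (linear_combination ((a : R) - b) * hε) | (linear_combination ((b : R) - a) * hε)
  rw [← leviElt_eq_torusElt (R := R) (σ := σ) hσ a b D rfl, ← leviElt_eq_torusElt (R := R) (σ := σ) hσ a' b' D' rfl,
    leviElt_mul, leviElt_mul, hGL]

end Summit.HodgeConjecture.HodgeConjecture.Cruxes.HLiu418.K2LiuDoubledUTwoTwoStepRelations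

end
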